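import Summits.Ventures.YMGap.RobustBall.MassGapOfDoor
import Summits.Ventures.YMGap.RobustBall.RobustMassGapDoorKR
import Summits.Ventures.YMGap.SlabAreaLawDimensions
import HarnessLib

/-!
# Venture YMGap — ROBUST-BALL (Y2): the `ℤ^d` mass gap on the ball THROUGH THE QUARTER DOOR — the member's
# `PerturbedMassGapAt` from an arbitrary one-link Kantorovich–Rubinstein modulus, and the `SU(2)` rows with `K = 1`

HONEST FRAMING: venture file (cell `pub-ymgap`, seat ds-4), strong-coupling LATTICE bookkeeping for perturbed `SU(N)`
lattice gauge theory on `ℤ^d` (rb-p1's `perturbedYM`, currency `PerturbedMassGapAt` of `MassGapOnBall`); nothing about the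
continuum or a Clay-sense mass gap.  Numeric `(β_W, ε)` rows are certified elsewhere (rb-ref lineage R / rb-theory `rb_rows.py`,
column `Qgap`); this file states the door condition analytically.

CONTENT (rb-p1/rb-theory split of 20:25–20:27Z: rb-p1's generic layer `MassGapOfDoor.perturbedMassGapAt_of_isKRContraction`,
ds-4's instantiation `RobustMassGapDoorKR.isKRContraction_perturbedYM_of_oneLinkKRModulus`):
* `perturbedMassGapAt_of_oneLinkKRModulus` — for every `d ≥ 1`, `N ≥ 1`, any `OneLinkKRModulus N b K` on `b ≥ 2(d−1)|β|`, any
  continuous link potential `W` (terms depending on their own links, supported by `supp`, range `R`) with oscillation load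
  `≤ a`, SELF-Lipschitz load `≤ ℓ_s` and cross-Lipschitz load `≤ Λ`:  `6(d−1)|β| K e^{a}(1 + 2√N ℓ_s) + √N Λ < 1 ⇒
  PerturbedMassGapAt d N β W supp` (unique DLR state + exponential clustering, rate `−log max(ρ,½)/max(1,R)`).
* `su2_perturbedMassGapAt_quarter` — `SU(2)`, every `d`, quarter modulus `K = 1` on `‖B‖_op ≤ 1`
  (`SlabAreaLawDimensions.su2_oneLinkKRModulus_of_le_one`, valid while `(d−1)|β_W|/2 ≤ 1`), Wilson units `β = β_W/4`:
  `(3/2)(d−1)|β_W| e^{a}(1 + 2√2 ℓ_s) + √2 Λ < 1 ⇒ PerturbedMassGapAt d 2 (β_W/4) W supp`;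
  `su2_perturbedMassGapAt_quarter_dim4`: `(9/2)|β_W| e^{a}(1 + 2√2 ℓ_s) + √2 Λ < 1` (`|β_W| ≤ 2/3`).
  At `a = ℓ_s = Λ = 0` this is the quarter-modulus Wilson window `β_W < 2/9` (`d = 4`) against the variance door's `1/6`
  (`MassGapOnBall.su2_massGapOnBallZd_dim4`): rb-theory's column `Qgap` — `(β_W, ε) = (1/8, 0.130)`, `(1/6, 0.062)`,
  `(1/5, 0.022)` in the convention `a = 2ε`, `ℓ_s + Λ ≤ ε` — rests on THIS door.  (The `ℤ^d` ball structure `MemBallZd` of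
  `MassGapOnBall` carries no self-Lipschitz load, so the rows here are stated over explicit load witnesses, exactly the
  hypotheses of `MassGapOfDoor`.)
-/

noncomputable section

open MeasureTheory Filter Function ProbabilityTheory Real
open scoped NNReal
open Literature.Probability.LatticeModels
open Literature.Probability.LatticeModels.DobrushinMetric
open Literature.MathematicalPhysics.QuantumLattice
open Literature.MathematicalPhysics.QuantumFieldTheory hiding ZdEdge
open Literature.MathematicalPhysics.QuantumFieldTheory.Balaban1983to89.StrongCouplingDobrushinWindow (OneLinkKRModulus)

namespace Summit.Ventures.YMGap.RobustBall

variable {d N : ℕ}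

/-- **MASS GAP OF A MEMBER THROUGH THE KANTOROVICH–RUBINSTEIN DOOR.**  Let `d ≥ 1`, `N ≥ 1`, `β` a 't Hooft coupling,
`OneLinkKRModulus N b K` with `K ≥ 0` on `b ≥ 2(d−1)|β|`; let `W` be a link potential with continuous terms depending only on
their own links, supported by `supp` with range `R`, and load witnesses: oscillation `Σ_{X ∋ e} osc X e ≤ a`, self-Lipschitz
`Σ_{X ∋ e} lip X e ≤ ℓ_s` (`ℓ_s ≥ 0`), cross-Lipschitz `Σ_{y} Σ_{X ∋ e} lip X y ≤ Λ`.  If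
`6(d−1)|β| · K e^{a}(1 + 2√N ℓ_s) + √N Λ < 1` then `PerturbedMassGapAt d N β W supp` — rb-p1's generic
`perturbedMassGapAt_of_isKRContraction` fed with `isKRContraction_perturbedYM_of_oneLinkKRModulus` and `sum_perturbedNbr_coeffKR_le`.
[folklore] -/
theorem perturbedMassGapAt_of_oneLinkKRModulus (hd : 1 ≤ d) (hN : 1 ≤ N) {β b K a ℓs Λ R : ℝ}
    (hK : 0 ≤ K) (hℓs : 0 ≤ ℓs) (hb : |β| * (2 * ((d : ℝ) - 1)) ≤ b) (hmod : OneLinkKRModulus N b K)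
    {W : Potential (ZdEdge d) (Matrix.specialUnitaryGroup (Fin N) ℂ)} (hWc : ∀ X, Continuous (W X))
    (hWdep : ∀ X, DependsOn (W X) (↑X : Set (ZdEdge d)))
    {supp : Finset (ZdEdge d) → Finset (Finset (ZdEdge d))} (hsupp : W.IsSupportedBy supp)
    {osc : Finset (ZdEdge d) → ZdEdge d → ℝ} (hosc : ∀ X, Dobrushin.IsOscBound (W X) (osc X))
    (hosca : ∀ e, ∑ X ∈ (supp {e}).filter (fun X => e ∈ X), osc X e ≤ a)
    {lip : Finset (ZdEdge d) → ZdEdge d → ℝ} (hlip : ∀ X, IsLipBound suFrobDist (W X) (lip X))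
    (hlips : ∀ e, ∑ X ∈ (supp {e}).filter (fun X => e ∈ X), lip X e ≤ ℓs)
    (hΛ : ∀ e, ∑ y ∈ perturbedNbr supp e, ∑ X ∈ (supp {e}).filter (fun X => e ∈ X), lip X y ≤ Λ)
    (hR : ∀ e, ∀ X ∈ supp {e}, e ∈ X → ∀ y ∈ X, ‖e.1 - y.1‖ ≤ R)
    (hρ : 6 * ((d : ℝ) - 1) * |β| * (K * exp a * (1 + 2 * Real.sqrt N * ℓs)) + Real.sqrt N * Λ < 1) :
    PerturbedMassGapAt d N β W supp := by
  have hW : W.IsAdapted := fun X => ⟨hWdep X, (hWc X).measurable⟩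
  exact perturbedMassGapAt_of_isKRContraction hd hWc hWdep hsupp
    (isKRContraction_perturbedYM_of_oneLinkKRModulus hd hN hK hℓs hb hmod hW (supp := supp) hosc hosca hlip hlips)
    (sum_perturbedNbr_coeffKR_le (N := N) hd (β := β) (a := a) hK hℓs hΛ) hρ hR

/-- **`SU(2)`, EVERY DIMENSION, QUARTER DOOR** (Wilson units: 't Hooft `β = β_W/4`, tree coupling `β_W/2`): the `SU(2)`
one-link modulus `K = 1` on `‖B‖_op ≤ 1` (`su2_oneLinkKRModulus_of_le_one`; radius `2(d−1)|β_W|/4 ≤ 1`) gives, for every member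
as above with loads `(a, ℓ_s, Λ)` and `(3/2)(d−1)|β_W| e^{a}(1 + 2√2 ℓ_s) + √2 Λ < 1`, `PerturbedMassGapAt d 2 (β_W/4) W supp`.
At zero loads: the quarter-modulus Wilson window `(3/2)(d−1)β_W < 1` (`d = 4`: `β_W < 2/9`). [folklore] -/
theorem su2_perturbedMassGapAt_quarter (hd : 1 ≤ d) {βW a ℓs Λ R : ℝ} (hℓs : 0 ≤ ℓs)
    (hrad : |βW / 4| * (2 * ((d : ℝ) - 1)) ≤ 1)
    {W : Potential (ZdEdge d) (Matrix.specialUnitaryGroup (Fin 2) ℂ)} (hWc : ∀ X, Continuous (W X))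
    (hWdep : ∀ X, DependsOn (W X) (↑X : Set (ZdEdge d)))
    {supp : Finset (ZdEdge d) → Finset (Finset (ZdEdge d))} (hsupp : W.IsSupportedBy supp)
    {osc : Finset (ZdEdge d) → ZdEdge d → ℝ} (hosc : ∀ X, Dobrushin.IsOscBound (W X) (osc X))
    (hosca : ∀ e, ∑ X ∈ (supp {e}).filter (fun X => e ∈ X), osc X e ≤ a)
    {lip : Finset (ZdEdge d) → ZdEdge d → ℝ} (hlip : ∀ X, IsLipBound suFrobDist (W X) (lip X))
    (hlips : ∀ e, ∑ X ∈ (supp {e}).filter (fun X => e ∈ X), lip X e ≤ ℓs)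
    (hΛ : ∀ e, ∑ y ∈ perturbedNbr supp e, ∑ X ∈ (supp {e}).filter (fun X => e ∈ X), lip X y ≤ Λ)
    (hR : ∀ e, ∀ X ∈ supp {e}, e ∈ X → ∀ y ∈ X, ‖e.1 - y.1‖ ≤ R)
    (hρ : 3 / 2 * ((d : ℝ) - 1) * |βW| * (exp a * (1 + 2 * Real.sqrt 2 * ℓs)) + Real.sqrt 2 * Λ < 1) :
    PerturbedMassGapAt d 2 (βW / 4) W supp := by
  have hmod : OneLinkKRModulus 2 (|βW / 4| * (2 * ((d : ℝ) - 1))) 1 :=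
    SlabAreaLawDimensions.su2_oneLinkKRModulus_of_le_one hrad
  refine perturbedMassGapAt_of_oneLinkKRModulus hd (by norm_num) zero_le_one hℓs le_rfl hmod hWc hWdep hsupp hosc hosca
    hlip hlips hΛ hR ?_
  have h4 : |βW / 4| = |βW| / 4 := by rw [abs_div, abs_of_pos (by norm_num : (0 : ℝ) < 4)]
  have h2 : ((2 : ℕ) : ℝ) = 2 := by norm_num
  rw [h4, h2]
  calc 6 * ((d : ℝ) - 1) * (|βW| / 4) * (1 * exp a * (1 + 2 * Real.sqrt 2 * ℓs)) + Real.sqrt 2 * Λ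
      = 3 / 2 * ((d : ℝ) - 1) * |βW| * (exp a * (1 + 2 * Real.sqrt 2 * ℓs)) + Real.sqrt 2 * Λ := by ring
    _ < 1 := hρ

/-- **`SU(2)`, `d = 4`, QUARTER DOOR**: for `|β_W| ≤ 2/3` and every member with loads `(a, ℓ_s, Λ)` satisfying
`(9/2)|β_W| e^{a}(1 + 2√2 ℓ_s) + √2 Λ < 1`, `PerturbedMassGapAt 4 2 (β_W/4) W supp` — the door behind rb-theory's column
`Qgap` (`(β_W, ε) = (1/8, 0.130), (1/6, 0.062), (1/5, 0.022)` with `a = 2ε`, `ℓ_s + Λ ≤ ε`, certified in exact rationals by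
the rows pipeline); zero loads: `β_W < 2/9`. [folklore] -/
theorem su2_perturbedMassGapAt_quarter_dim4 {βW a ℓs Λ R : ℝ} (hℓs : 0 ≤ ℓs) (hβ : |βW| ≤ 2 / 3)
    {W : Potential (ZdEdge 4) (Matrix.specialUnitaryGroup (Fin 2) ℂ)} (hWc : ∀ X, Continuous (W X))
    (hWdep : ∀ X, DependsOn (W X) (↑X : Set (ZdEdge 4)))
    {supp : Finset (ZdEdge 4) → Finset (Finset (ZdEdge 4))} (hsupp : W.IsSupportedBy supp)
    {osc : Finset (ZdEdge 4) → ZdEdge 4 → ℝ} (hosc : ∀ X, Dobrushin.IsOscBound (W X) (osc X))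
    (hosca : ∀ e, ∑ X ∈ (supp {e}).filter (fun X => e ∈ X), osc X e ≤ a)
    {lip : Finset (ZdEdge 4) → ZdEdge 4 → ℝ} (hlip : ∀ X, IsLipBound suFrobDist (W X) (lip X))
    (hlips : ∀ e, ∑ X ∈ (supp {e}).filter (fun X => e ∈ X), lip X e ≤ ℓs)
    (hΛ : ∀ e, ∑ y ∈ perturbedNbr supp e, ∑ X ∈ (supp {e}).filter (fun X => e ∈ X), lip X y ≤ Λ)
    (hR : ∀ e, ∀ X ∈ supp {e}, e ∈ X → ∀ y ∈ X, ‖e.1 - y.1‖ ≤ R)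
    (hρ : 9 / 2 * |βW| * (exp a * (1 + 2 * Real.sqrt 2 * ℓs)) + Real.sqrt 2 * Λ < 1) :
    PerturbedMassGapAt 4 2 (βW / 4) W supp := by
  have hrad : |βW / 4| * (2 * (((4 : ℕ) : ℝ) - 1)) ≤ 1 := by
    rw [abs_div, abs_of_pos (by norm_num : (0 : ℝ) < 4)]
    have := abs_nonneg βW
    nlinarith
  refine su2_perturbedMassGapAt_quarter (d := 4) (by norm_num) hℓs hrad hWc hWdep hsupp hosc hosca hlip hlips hΛ hR ?_
  calc 3 / 2 * (((4 : ℕ) : ℝ) - 1) * |βW| * (exp a * (1 + 2 * Real.sqrt 2 * ℓs)) + Real.sqrt 2 * Λ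
      = 9 / 2 * |βW| * (exp a * (1 + 2 * Real.sqrt 2 * ℓs)) + Real.sqrt 2 * Λ := by norm_num
    _ < 1 := hρ

end Summit.Ventures.YMGap.RobustBall
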